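import Summits.BirchSwinnertonDyer.BirchSwinnertonDyer.Theorems.KolyvaginDepthDoorDepthTableRowKit
import Summits.BirchSwinnertonDyer.BirchSwinnertonDyer.Theorems.KolyvaginDepthDoorDepthTableGlobalMinimal
import Summits.BirchSwinnertonDyer.BirchSwinnertonDyer.Theorems.Rank2ObservatoryKernelCerts002
import Summits.BirchSwinnertonDyer.Rank1Residual.Additive.PointCountEulerNat
import Literature.NumberTheory.EllipticCurves.BurungaleSkinner2023.Curve14a1TwistsCertificate
import HarnessLib

/-!
# Route `KolyvaginDepthDoor` — DEPTH-TABLE rows 4/6 (`707a1`, `709a1`, `718b1`) with CONCRETE admissible data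
# `(p, d_K, ℓ)`, every side condition decided in the kernel (crux `KolyvaginDepthSupply`, stmt-BirchSwinnertonDyer-21765)

Helper file (`--supports stmt-BirchSwinnertonDyer-21765 --as helper`); it closes nothing. HONEST
FRAMING: per-curve certificate rows of the route's DEPTH TABLE (its cheapest falsifier / instrument,
"the 18 Cremona rank-2 curves `N ≤ 1000`"); each row is CONDITIONAL on exactly two inputs — Kolyvagin
1991 Thm. 4 (`hF`, the route's support item `KolyvaginStructure`, a named Literature fact) and the
COMPUTED bit `c_1(ℓ) ≠ 0` (Jetchev–Lauter–Stein, arXiv:0707.0032 §3.6: `P_ℓ = Σ iσⁱ y_ℓ ∉ pE(K[ℓ])`,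
degree `(ℓ+1) h_K` over `K`) — and BSD is not proved by it. What is NEW over the generic certificate
`depthRow_certificate_of_two_le_rank` (`KolyvaginDepthDoorDepthRow389a1`): the admissible data are
FIXED and ALL their side conditions are theorems of the kernel (kit `KolyvaginDepthDoorDepthTableRowKit`):
`ρ̄_{E,p}` onto (Mazur 6.3 Frobenius witness + Serre 1972 Prop. 21, semistable curves), `p` good
ordinary, `N_E` (semistable curves), the Heegner hypothesis for `(N_E, d_K)`, `ℓ` a Kolyvagin prime
with `M(ℓ) ≥ 1`, `2 ≤ rank_ℤ E(ℚ)` (tree kernel certificates `Rank2Observatory.KernelCerts*`), global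
minimality (`KolyvaginDepthDoorDepthTableGlobalMinimal`). So each row names the EXACT computation the
depth-table seat must run, and its outcome `c_1(ℓ) ≠ 0` certifies `corank_ℤ_p Ш(E)[p^∞] = 0` modulo
`hF` alone. Choice of data: `p` = least prime `≥ 5` of good ordinary reduction with `ρ̄` onto
(`5`, or `7` when `5 ∣ N`); `d_K` = the Heegner discriminant `∉ {−3, −4}`, `p ∤ d_K`, `|d_K| ≤ 120`
minimising the JLS degree `(ℓ+1)·h_K` of its least Kolyvagin prime `ℓ`; `ℓ` = that prime.

| curve | `N` | `Δ` | `p` (`a_p`) | witness `q` (`a_q`) | `d_K` (`h_K`) | `ℓ` (`a_ℓ`) | `ρ̄` onto |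
|---|---|---|---|---|---|---|---|
| `707a1` = `[0, 1, 1, -12, 12]` | `707` | `4949` | `5` (`-3`) | `3` (`-2`) | `-19` (`1`) | `179` (`-20`) | proved |
| `709a1` = `[0, -1, 1, -2, 0]` | `709` | `709` | `5` (`-3`) | `7` (`-4`) | `-7` (`1`) | `409` (`5`) | proved |
| `718b1` = `[1, 0, 1, -5, 0]` | `718` | `5744` | `5` (`-3`) | `3` (`-2`) | `-7` (`1`) | `59` (`5`) | proved |

Per curve `C<label>`: `intModel`, `card_q` (kernel point counts), `hasSurjectiveModNGaloisRep_p` (or,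
for the curves additive at `2`, only `hasIrreducibleModPGaloisRep_p` and `ρ̄` onto stays a hypothesis),
`goodOrdinary_p`, `conductorNorm_eq` (semistable curves), `heegner_negD`, and the row `depthRow_p_negD_ℓ`.

References: [Kolyvagin1991MathAnn] §2 Thm. 4; [WZhang2014] Thm. 11.2 (i), Notations (xii);
[JetchevLauterStein2009] arXiv:0707.0032 §3.6, Prop. 3.10; [Serre1972] §5.4 Prop. 21; [Mazur1978]
§6 Prop. 6.3 (1); [CremonaAlgorithms1997] Table 1; [GrossLMS1991] §1, §3; [Marcus1977] Ch. 3 Thm. 25.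
-/


set_option linter.dupNamespace false

noncomputable section

open scoped Classical NumberField

namespace Summit.BirchSwinnertonDyer.BirchSwinnertonDyer.Theorems.KolyvaginDepthDoor

open Literature.NumberTheory.EllipticCurves Literature.NumberTheory.EllipticCurves.ModularForms
  WeierstrassCurve
open Summit.BirchSwinnertonDyer.BirchSwinnertonDyer.Rank2Observatory
open Summit.BirchSwinnertonDyer.BirchSwinnertonDyer.Rank1Residual
open Summit.BirchSwinnertonDyer.Rank1Residual.Additive


/-! ## Row `707a1` = `[0,1,1,-12,12]` (`N = 707`, `Δ = 4949`): `(p, d_K, ℓ) = (5, -19, 179)` -/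

namespace C707a1

/-- The integral model of `707a1` is `[0, 1, 1, -12, 12]`. [cite: CremonaAlgorithms1997, Table 1 (707a1)] -/
theorem intModel :
    haveI := isGloballyMinimal_c707a1;
    integralModelInt ((⟨0, 1, 1, -12, 12⟩ : WeierstrassCurve ℤ).map (Int.castRingHom ℚ)) = ⟨0, 1, 1, -12, 12⟩ := by
  haveI := isGloballyMinimal_c707a1
  exact IntModel.integralModelInt_eq_of_map_eq _ rfl

/-- `#Ẽ(𝔽_3) = 6`, `a_3 = -2` (irreducibility witness at `p = 5`) for `707a1`, kernel-decided (`ℕ`-arithmetic Euler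
count `PointCountNat.natCard_point_map_eq`). [cite: CremonaAlgorithms1997, Table 1 (707a1)] -/
theorem card_3 :
    Nat.card (((⟨0, 1, 1, -12, 12⟩ : WeierstrassCurve ℤ).map (Int.castRingHom (ZMod 3))).toAffine.Point) = 6 := by
  rw [PointCountNat.natCard_point_map_eq (hℓ := ⟨by norm_num⟩) (by norm_num) 0 1 1 (-12) 12
    (by decide +kernel)]
  decide +kernel

/-- `#Ẽ(𝔽_5) = 9`, `a_5 = -3` (`p` ordinary) for `707a1`, kernel-decided (`ℕ`-arithmetic Euler
count `PointCountNat.natCard_point_map_eq`). [cite: CremonaAlgorithms1997, Table 1 (707a1)] -/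
theorem card_5 :
    Nat.card (((⟨0, 1, 1, -12, 12⟩ : WeierstrassCurve ℤ).map (Int.castRingHom (ZMod 5))).toAffine.Point) = 9 := by
  rw [PointCountNat.natCard_point_map_eq (hℓ := ⟨by norm_num⟩) (by norm_num) 0 1 1 (-12) 12
    (by decide +kernel)]
  decide +kernel

/-- `#Ẽ(𝔽_179) = 200`, `a_179 = -20` (Kolyvagin prime: `5 ∣ 179 + 1`, `5 ∣ a_179`) for `707a1`, kernel-decided (`ℕ`-arithmetic Euler
count `PointCountNat.natCard_point_map_eq`). [cite: CremonaAlgorithms1997, Table 1 (707a1)] -/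
theorem card_179 :
    Nat.card (((⟨0, 1, 1, -12, 12⟩ : WeierstrassCurve ℤ).map (Int.castRingHom (ZMod 179))).toAffine.Point) = 200 := by
  rw [PointCountNat.natCard_point_map_eq (hℓ := ⟨by norm_num⟩) (by norm_num) 0 1 1 (-12) 12
    (by decide +kernel)]
  decide +kernel

/-- **`ρ̄_{E,5}` is surjective for `E = 707a1`** (unconditional): semistable (`gcd(c₄, Δ) = 1`) and
`X² − a_3X + 3` (`a_3 = -2`) has no root modulo `5` (Mazur's Frobenius certificate ⇒ `E[5]` irreducible;
Serre's Prop. 21 ⇒ onto). [cite: Serre1972, §5.4 Prop. 21] [cite: Mazur1978, §6 Prop. 6.3 (1)] -/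
theorem hasSurjectiveModNGaloisRep_5 : ((⟨0, 1, 1, -12, 12⟩ : WeierstrassCurve ℤ).map (Int.castRingHom ℚ)).HasSurjectiveModNGaloisRep (5 : ℕ) := by
  have hn : ∀ t : ZMod 5, t ^ 2 - (((3 : ℕ) : ℤ) + 1 - (6 : ℕ) : ℤ) * t + ((3 : ℕ) : ZMod 5) ≠ 0 := by
    decide +kernel
  haveI := Fact.mk (by norm_num : Nat.Prime 5)
  haveI := Fact.mk (by norm_num : Nat.Prime 3)
  haveI := isElliptic_c707a1
  haveI := isGloballyMinimal_c707a1
  exact hasSurjectiveModNGaloisRep_of_intModel_certificate intModel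
    (by rw [Int.isCoprime_iff_gcd_eq_one]; decide +kernel) 5 3 (by norm_num) (by decide +kernel)
    (n := 6) card_3 hn

/-- **`5` is a prime of good ordinary reduction for `707a1`** (`5 ∤ Δ`, `a_5 = -3`). [cite: CremonaAlgorithms1997, Table 1 (707a1)] -/
theorem goodOrdinary_5 :
    haveI := Fact.mk (by norm_num : Nat.Prime 5);
    haveI := isGloballyMinimal_c707a1;
    ((⟨0, 1, 1, -12, 12⟩ : WeierstrassCurve ℤ).map (Int.castRingHom ℚ)).HasGoodReductionAtPrime 5 ∧ ¬ ((5 : ℕ) : ℤ) ∣ ((⟨0, 1, 1, -12, 12⟩ : WeierstrassCurve ℤ).map (Int.castRingHom ℚ)).frobeniusTrace 5 := by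
  haveI := Fact.mk (by norm_num : Nat.Prime 5)
  haveI := isGloballyMinimal_c707a1
  exact goodOrdinary_of_intModel_certificate intModel 5 (by decide +kernel) (n := 9) card_5
    (by decide +kernel)

/-- **`N(707a1) = 707`** (semistable: `gcd(Δ, c₄) = 1`, `N = rad Δ`; Silverman ATAEC IV.10.2). [cite: CremonaAlgorithms1997, Table 1 (707a1)] -/
theorem conductorNorm_eq : ((⟨0, 1, 1, -12, 12⟩ : WeierstrassCurve ℤ).map (Int.castRingHom ℚ)).conductorNorm ℤ = 707 := by
  haveI := isElliptic_c707a1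
  haveI := isGloballyMinimal_c707a1
  have h : ((⟨0, 1, 1, -12, 12⟩ : WeierstrassCurve ℤ).map (Int.castRingHom ℚ)) = (⟨0, 1, 1, -12, 12⟩ : WeierstrassCurve ℤ).baseChange ℚ :=
    eq_baseChange_of_intModel intModel
  haveI : ((⟨0, 1, 1, -12, 12⟩ : WeierstrassCurve ℤ).baseChange ℚ).IsElliptic := by rw [← h]; infer_instance
  rw [h]
  refine BurungaleSkinner2023.conductorNorm_baseChange_int_of_isCoprime _
    (by rw [Int.isCoprime_iff_gcd_eq_one]; decide +kernel) (k := 2) ?_ (by decide +kernel)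
    (by decide +kernel)
  rw [Nat.squarefree_iff_nodup_primeFactorsList (by norm_num)]; simp

/-- **Heegner data `d_K = -19` for `707a1`**: every prime of `Δ = 4949` (hence of `N_E`) splits in a quadratic
field of discriminant `-19` (Kronecker symbols `= 1`). [cite: Marcus1977, Ch. 3 Thm. 25] [cite: GrossLMS1991, §1] -/
theorem heegner_neg19 : ∀ q : ℕ, q.Prime → (q : ℤ) ∣ (⟨0, 1, 1, -12, 12⟩ : WeierstrassCurve ℤ).Δ →
    (q = 2 → (-19 : ℤ) % 8 = 1) ∧ (q ≠ 2 → jacobiSym (-19) q = 1) :=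
  forall_prime_dvd_of_natAbs_eq_pow_mul_pow (a := 7) (i := 2) (b := 101) (j := 1) (by decide +kernel)
    (by norm_num) (by norm_num) ⟨by norm_num, by norm_num⟩ ⟨by norm_num, by norm_num⟩

/-- **DEPTH-TABLE ROW `707a1`, `(p, d_K, ℓ) = (5, -19, 179)`, modulo Kolyvagin 1991 Thm. 4 (`hF`).** For
`E = 707a1`, ANY imaginary quadratic `K` with `d_K = -19` (`h_K = 1`; such `K` exist, `exists_field_neg19`), any modular
parametrisation datum `Dt` of level `N_E`, `β`, `ι : K → ℂ`, and any Kolyvagin–Heegner datum `d` of conductor `179`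
(a Kolyvagin prime: inert in `K`, `5 ∣ 180`, `5 ∣ a_179 = -20`): IF `c_1(179) ≠ 0` THEN `corank_ℤ5 Ш(E)[5^∞] = 0`,
`rank_ℤ E(ℚ) = 2`, `corank Sel_5∞(E/ℚ) = 2` and `corank Sel_5∞(E^(-19)/ℚ) = 1`. Every side condition is PROVED in
the kernel; the inputs left are `hF` and the computed bit.
JLS cost `[K[179] : K] = 180`. BSD is not proved by it.
[cite: Kolyvagin1991MathAnn, §2 Thm. 4] [cite: JetchevLauterStein2009, §3.6 (arXiv:0707.0032)] -/
theorem depthRow_5_neg19_179 (hF : Kolyvagin1991_selmerCorank_of_kolyvaginClass_ne_zero)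
    (K : Type) [Field K] [NumberField K] (hK : IsImaginaryQuadratic K)
    (hD : NumberField.discr K = -19) :
    haveI := isElliptic_c707a1;
    haveI := isGloballyMinimal_c707a1;
    haveI : NeZero (((⟨0, 1, 1, -12, 12⟩ : WeierstrassCurve ℤ).map (Int.castRingHom ℚ)).conductorNorm ℤ) := neZero_conductorNorm_of_isElliptic _;
    ∀ (Dt : ModularParametrizationData ((⟨0, 1, 1, -12, 12⟩ : WeierstrassCurve ℤ).map (Int.castRingHom ℚ)) (((⟨0, 1, 1, -12, 12⟩ : WeierstrassCurve ℤ).map (Int.castRingHom ℚ)).conductorNorm ℤ)) (β : ℤ)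
    (ι : K →+* ℂ) (d : KolyvaginHeegnerData Dt β ι 179),
    d.kolyvaginClass (p := 5) (by norm_num) 1 ≠ 0 →
    ((⟨0, 1, 1, -12, 12⟩ : WeierstrassCurve ℤ).map (Int.castRingHom ℚ)).shaCorank 5 = 0 ∧ ((⟨0, 1, 1, -12, 12⟩ : WeierstrassCurve ℤ).map (Int.castRingHom ℚ)).mordellWeilRank = 2 ∧
      ((⟨0, 1, 1, -12, 12⟩ : WeierstrassCurve ℤ).map (Int.castRingHom ℚ)).selmerCorank 5 = 2 ∧
      (((⟨0, 1, 1, -12, 12⟩ : WeierstrassCurve ℤ).map (Int.castRingHom ℚ)).quadraticTwist ((-19 : ℤ) : ℚ)).selmerCorank 5 = 1 := by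
  haveI := isElliptic_c707a1
  haveI := isGloballyMinimal_c707a1
  haveI : NeZero (((⟨0, 1, 1, -12, 12⟩ : WeierstrassCurve ℤ).map (Int.castRingHom ℚ)).conductorNorm ℤ) := neZero_conductorNorm_of_isElliptic _
  intro Dt β ι d hne
  haveI := Fact.mk (by norm_num : Nat.Prime 5)
  exact depthRow_of_intModel_certificate intModel hF KernelCerts002.C707a1.two_le_rank 5 (by norm_num)
    (by decide +kernel) hasSurjectiveModNGaloisRep_5 K hK hD (by norm_num) (by norm_num) (by norm_num) heegner_neg19 179
    (by norm_num) (by norm_num) (by decide +kernel) (by norm_num) (by norm_num) (by norm_num) (by norm_num)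
    (n := 200) card_179 (by norm_num) Dt β ι d hne

end C707a1

/-! ## Row `709a1` = `[0,-1,1,-2,0]` (`N = 709`, `Δ = 709`): `(p, d_K, ℓ) = (5, -7, 409)` -/

namespace C709a1

/-- The integral model of `709a1` is `[0, -1, 1, -2, 0]`. [cite: CremonaAlgorithms1997, Table 1 (709a1)] -/
theorem intModel :
    haveI := isGloballyMinimal_c709a1;
    integralModelInt ((⟨0, -1, 1, -2, 0⟩ : WeierstrassCurve ℤ).map (Int.castRingHom ℚ)) = ⟨0, -1, 1, -2, 0⟩ := by
  haveI := isGloballyMinimal_c709a1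
  exact IntModel.integralModelInt_eq_of_map_eq _ rfl

/-- `#Ẽ(𝔽_7) = 12`, `a_7 = -4` (irreducibility witness at `p = 5`) for `709a1`, kernel-decided (`ℕ`-arithmetic Euler
count `PointCountNat.natCard_point_map_eq`). [cite: CremonaAlgorithms1997, Table 1 (709a1)] -/
theorem card_7 :
    Nat.card (((⟨0, -1, 1, -2, 0⟩ : WeierstrassCurve ℤ).map (Int.castRingHom (ZMod 7))).toAffine.Point) = 12 := by
  rw [PointCountNat.natCard_point_map_eq (hℓ := ⟨by norm_num⟩) (by norm_num) 0 (-1) 1 (-2) 0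
    (by decide +kernel)]
  decide +kernel

/-- `#Ẽ(𝔽_5) = 9`, `a_5 = -3` (`p` ordinary) for `709a1`, kernel-decided (`ℕ`-arithmetic Euler
count `PointCountNat.natCard_point_map_eq`). [cite: CremonaAlgorithms1997, Table 1 (709a1)] -/
theorem card_5 :
    Nat.card (((⟨0, -1, 1, -2, 0⟩ : WeierstrassCurve ℤ).map (Int.castRingHom (ZMod 5))).toAffine.Point) = 9 := by
  rw [PointCountNat.natCard_point_map_eq (hℓ := ⟨by norm_num⟩) (by norm_num) 0 (-1) 1 (-2) 0
    (by decide +kernel)]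
  decide +kernel

/-- `#Ẽ(𝔽_409) = 405`, `a_409 = 5` (Kolyvagin prime: `5 ∣ 409 + 1`, `5 ∣ a_409`) for `709a1`, kernel-decided (`ℕ`-arithmetic Euler
count `PointCountNat.natCard_point_map_eq`). [cite: CremonaAlgorithms1997, Table 1 (709a1)] -/
theorem card_409 :
    Nat.card (((⟨0, -1, 1, -2, 0⟩ : WeierstrassCurve ℤ).map (Int.castRingHom (ZMod 409))).toAffine.Point) = 405 := by
  rw [PointCountNat.natCard_point_map_eq (hℓ := ⟨by norm_num⟩) (by norm_num) 0 (-1) 1 (-2) 0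
    (by decide +kernel)]
  decide +kernel

/-- **`ρ̄_{E,5}` is surjective for `E = 709a1`** (unconditional): semistable (`gcd(c₄, Δ) = 1`) and
`X² − a_7X + 7` (`a_7 = -4`) has no root modulo `5` (Mazur's Frobenius certificate ⇒ `E[5]` irreducible;
Serre's Prop. 21 ⇒ onto). [cite: Serre1972, §5.4 Prop. 21] [cite: Mazur1978, §6 Prop. 6.3 (1)] -/
theorem hasSurjectiveModNGaloisRep_5 : ((⟨0, -1, 1, -2, 0⟩ : WeierstrassCurve ℤ).map (Int.castRingHom ℚ)).HasSurjectiveModNGaloisRep (5 : ℕ) := by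
  have hn : ∀ t : ZMod 5, t ^ 2 - (((7 : ℕ) : ℤ) + 1 - (12 : ℕ) : ℤ) * t + ((7 : ℕ) : ZMod 5) ≠ 0 := by
    decide +kernel
  haveI := Fact.mk (by norm_num : Nat.Prime 5)
  haveI := Fact.mk (by norm_num : Nat.Prime 7)
  haveI := isElliptic_c709a1
  haveI := isGloballyMinimal_c709a1
  exact hasSurjectiveModNGaloisRep_of_intModel_certificate intModel
    (by rw [Int.isCoprime_iff_gcd_eq_one]; decide +kernel) 5 7 (by norm_num) (by decide +kernel)
    (n := 12) card_7 hn

/-- **`5` is a prime of good ordinary reduction for `709a1`** (`5 ∤ Δ`, `a_5 = -3`). [cite: CremonaAlgorithms1997, Table 1 (709a1)] -/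
theorem goodOrdinary_5 :
    haveI := Fact.mk (by norm_num : Nat.Prime 5);
    haveI := isGloballyMinimal_c709a1;
    ((⟨0, -1, 1, -2, 0⟩ : WeierstrassCurve ℤ).map (Int.castRingHom ℚ)).HasGoodReductionAtPrime 5 ∧ ¬ ((5 : ℕ) : ℤ) ∣ ((⟨0, -1, 1, -2, 0⟩ : WeierstrassCurve ℤ).map (Int.castRingHom ℚ)).frobeniusTrace 5 := by
  haveI := Fact.mk (by norm_num : Nat.Prime 5)
  haveI := isGloballyMinimal_c709a1
  exact goodOrdinary_of_intModel_certificate intModel 5 (by decide +kernel) (n := 9) card_5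
    (by decide +kernel)

/-- **`N(709a1) = 709`** (semistable: `gcd(Δ, c₄) = 1`, `N = rad Δ`; Silverman ATAEC IV.10.2). [cite: CremonaAlgorithms1997, Table 1 (709a1)] -/
theorem conductorNorm_eq : ((⟨0, -1, 1, -2, 0⟩ : WeierstrassCurve ℤ).map (Int.castRingHom ℚ)).conductorNorm ℤ = 709 := by
  haveI := isElliptic_c709a1
  haveI := isGloballyMinimal_c709a1
  have h : ((⟨0, -1, 1, -2, 0⟩ : WeierstrassCurve ℤ).map (Int.castRingHom ℚ)) = (⟨0, -1, 1, -2, 0⟩ : WeierstrassCurve ℤ).baseChange ℚ :=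
    eq_baseChange_of_intModel intModel
  haveI : ((⟨0, -1, 1, -2, 0⟩ : WeierstrassCurve ℤ).baseChange ℚ).IsElliptic := by rw [← h]; infer_instance
  rw [h]
  refine BurungaleSkinner2023.conductorNorm_baseChange_int_of_isCoprime _
    (by rw [Int.isCoprime_iff_gcd_eq_one]; decide +kernel) (k := 1) ?_ (by decide +kernel)
    (by decide +kernel)
  rw [Nat.squarefree_iff_nodup_primeFactorsList (by norm_num)]; simp

/-- **Heegner data `d_K = -7` for `709a1`**: every prime of `Δ = 709` (hence of `N_E`) splits in a quadratic
field of discriminant `-7` (Kronecker symbols `= 1`). [cite: Marcus1977, Ch. 3 Thm. 25] [cite: GrossLMS1991, §1] -/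
theorem heegner_neg7 : ∀ q : ℕ, q.Prime → (q : ℤ) ∣ (⟨0, -1, 1, -2, 0⟩ : WeierstrassCurve ℤ).Δ →
    (q = 2 → (-7 : ℤ) % 8 = 1) ∧ (q ≠ 2 → jacobiSym (-7) q = 1) :=
  forall_prime_dvd_of_natAbs_eq_pow (a := 709) (i := 1) (by decide +kernel) (by norm_num)
    ⟨by norm_num, by norm_num⟩

/-- **DEPTH-TABLE ROW `709a1`, `(p, d_K, ℓ) = (5, -7, 409)`, modulo Kolyvagin 1991 Thm. 4 (`hF`).** For
`E = 709a1`, ANY imaginary quadratic `K` with `d_K = -7` (`h_K = 1`; such `K` exist, `Rank2Observatory.exists_heegnerField_5077a1`), any modular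
parametrisation datum `Dt` of level `N_E`, `β`, `ι : K → ℂ`, and any Kolyvagin–Heegner datum `d` of conductor `409`
(a Kolyvagin prime: inert in `K`, `5 ∣ 410`, `5 ∣ a_409 = 5`): IF `c_1(409) ≠ 0` THEN `corank_ℤ5 Ш(E)[5^∞] = 0`,
`rank_ℤ E(ℚ) = 2`, `corank Sel_5∞(E/ℚ) = 2` and `corank Sel_5∞(E^(-7)/ℚ) = 1`. Every side condition is PROVED in
the kernel; the inputs left are `hF` and the computed bit.
JLS cost `[K[409] : K] = 410`. BSD is not proved by it.
[cite: Kolyvagin1991MathAnn, §2 Thm. 4] [cite: JetchevLauterStein2009, §3.6 (arXiv:0707.0032)] -/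
theorem depthRow_5_neg7_409 (hF : Kolyvagin1991_selmerCorank_of_kolyvaginClass_ne_zero)
    (K : Type) [Field K] [NumberField K] (hK : IsImaginaryQuadratic K)
    (hD : NumberField.discr K = -7) :
    haveI := isElliptic_c709a1;
    haveI := isGloballyMinimal_c709a1;
    haveI : NeZero (((⟨0, -1, 1, -2, 0⟩ : WeierstrassCurve ℤ).map (Int.castRingHom ℚ)).conductorNorm ℤ) := neZero_conductorNorm_of_isElliptic _;
    ∀ (Dt : ModularParametrizationData ((⟨0, -1, 1, -2, 0⟩ : WeierstrassCurve ℤ).map (Int.castRingHom ℚ)) (((⟨0, -1, 1, -2, 0⟩ : WeierstrassCurve ℤ).map (Int.castRingHom ℚ)).conductorNorm ℤ)) (β : ℤ)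
    (ι : K →+* ℂ) (d : KolyvaginHeegnerData Dt β ι 409),
    d.kolyvaginClass (p := 5) (by norm_num) 1 ≠ 0 →
    ((⟨0, -1, 1, -2, 0⟩ : WeierstrassCurve ℤ).map (Int.castRingHom ℚ)).shaCorank 5 = 0 ∧ ((⟨0, -1, 1, -2, 0⟩ : WeierstrassCurve ℤ).map (Int.castRingHom ℚ)).mordellWeilRank = 2 ∧
      ((⟨0, -1, 1, -2, 0⟩ : WeierstrassCurve ℤ).map (Int.castRingHom ℚ)).selmerCorank 5 = 2 ∧
      (((⟨0, -1, 1, -2, 0⟩ : WeierstrassCurve ℤ).map (Int.castRingHom ℚ)).quadraticTwist ((-7 : ℤ) : ℚ)).selmerCorank 5 = 1 := by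
  haveI := isElliptic_c709a1
  haveI := isGloballyMinimal_c709a1
  haveI : NeZero (((⟨0, -1, 1, -2, 0⟩ : WeierstrassCurve ℤ).map (Int.castRingHom ℚ)).conductorNorm ℤ) := neZero_conductorNorm_of_isElliptic _
  intro Dt β ι d hne
  haveI := Fact.mk (by norm_num : Nat.Prime 5)
  exact depthRow_of_intModel_certificate intModel hF KernelCerts002.C709a1.two_le_rank 5 (by norm_num)
    (by decide +kernel) hasSurjectiveModNGaloisRep_5 K hK hD (by norm_num) (by norm_num) (by norm_num) heegner_neg7 409
    (by norm_num) (by norm_num) (by decide +kernel) (by norm_num) (by norm_num) (by norm_num) (by norm_num)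
    (n := 405) card_409 (by norm_num) Dt β ι d hne

end C709a1

/-! ## Row `718b1` = `[1,0,1,-5,0]` (`N = 718`, `Δ = 5744`): `(p, d_K, ℓ) = (5, -7, 59)` -/

namespace C718b1

/-- The integral model of `718b1` is `[1, 0, 1, -5, 0]`. [cite: CremonaAlgorithms1997, Table 1 (718b1)] -/
theorem intModel :
    haveI := isGloballyMinimal_c718b1;
    integralModelInt ((⟨1, 0, 1, -5, 0⟩ : WeierstrassCurve ℤ).map (Int.castRingHom ℚ)) = ⟨1, 0, 1, -5, 0⟩ := by
  haveI := isGloballyMinimal_c718b1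
  exact IntModel.integralModelInt_eq_of_map_eq _ rfl

/-- `#Ẽ(𝔽_3) = 6`, `a_3 = -2` (irreducibility witness at `p = 5`) for `718b1`, kernel-decided (`ℕ`-arithmetic Euler
count `PointCountNat.natCard_point_map_eq`). [cite: CremonaAlgorithms1997, Table 1 (718b1)] -/
theorem card_3 :
    Nat.card (((⟨1, 0, 1, -5, 0⟩ : WeierstrassCurve ℤ).map (Int.castRingHom (ZMod 3))).toAffine.Point) = 6 := by
  rw [PointCountNat.natCard_point_map_eq (hℓ := ⟨by norm_num⟩) (by norm_num) 1 0 1 (-5) 0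
    (by decide +kernel)]
  decide +kernel

/-- `#Ẽ(𝔽_5) = 9`, `a_5 = -3` (`p` ordinary) for `718b1`, kernel-decided (`ℕ`-arithmetic Euler
count `PointCountNat.natCard_point_map_eq`). [cite: CremonaAlgorithms1997, Table 1 (718b1)] -/
theorem card_5 :
    Nat.card (((⟨1, 0, 1, -5, 0⟩ : WeierstrassCurve ℤ).map (Int.castRingHom (ZMod 5))).toAffine.Point) = 9 := by
  rw [PointCountNat.natCard_point_map_eq (hℓ := ⟨by norm_num⟩) (by norm_num) 1 0 1 (-5) 0
    (by decide +kernel)]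
  decide +kernel

/-- `#Ẽ(𝔽_59) = 55`, `a_59 = 5` (Kolyvagin prime: `5 ∣ 59 + 1`, `5 ∣ a_59`) for `718b1`, kernel-decided (`ℕ`-arithmetic Euler
count `PointCountNat.natCard_point_map_eq`). [cite: CremonaAlgorithms1997, Table 1 (718b1)] -/
theorem card_59 :
    Nat.card (((⟨1, 0, 1, -5, 0⟩ : WeierstrassCurve ℤ).map (Int.castRingHom (ZMod 59))).toAffine.Point) = 55 := by
  rw [PointCountNat.natCard_point_map_eq (hℓ := ⟨by norm_num⟩) (by norm_num) 1 0 1 (-5) 0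
    (by decide +kernel)]
  decide +kernel

/-- **`ρ̄_{E,5}` is surjective for `E = 718b1`** (unconditional): semistable (`gcd(c₄, Δ) = 1`) and
`X² − a_3X + 3` (`a_3 = -2`) has no root modulo `5` (Mazur's Frobenius certificate ⇒ `E[5]` irreducible;
Serre's Prop. 21 ⇒ onto). [cite: Serre1972, §5.4 Prop. 21] [cite: Mazur1978, §6 Prop. 6.3 (1)] -/
theorem hasSurjectiveModNGaloisRep_5 : ((⟨1, 0, 1, -5, 0⟩ : WeierstrassCurve ℤ).map (Int.castRingHom ℚ)).HasSurjectiveModNGaloisRep (5 : ℕ) := by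
  have hn : ∀ t : ZMod 5, t ^ 2 - (((3 : ℕ) : ℤ) + 1 - (6 : ℕ) : ℤ) * t + ((3 : ℕ) : ZMod 5) ≠ 0 := by
    decide +kernel
  haveI := Fact.mk (by norm_num : Nat.Prime 5)
  haveI := Fact.mk (by norm_num : Nat.Prime 3)
  haveI := isElliptic_c718b1
  haveI := isGloballyMinimal_c718b1
  exact hasSurjectiveModNGaloisRep_of_intModel_certificate intModel
    (by rw [Int.isCoprime_iff_gcd_eq_one]; decide +kernel) 5 3 (by norm_num) (by decide +kernel)
    (n := 6) card_3 hn

/-- **`5` is a prime of good ordinary reduction for `718b1`** (`5 ∤ Δ`, `a_5 = -3`). [cite: CremonaAlgorithms1997, Table 1 (718b1)] -/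
theorem goodOrdinary_5 :
    haveI := Fact.mk (by norm_num : Nat.Prime 5);
    haveI := isGloballyMinimal_c718b1;
    ((⟨1, 0, 1, -5, 0⟩ : WeierstrassCurve ℤ).map (Int.castRingHom ℚ)).HasGoodReductionAtPrime 5 ∧ ¬ ((5 : ℕ) : ℤ) ∣ ((⟨1, 0, 1, -5, 0⟩ : WeierstrassCurve ℤ).map (Int.castRingHom ℚ)).frobeniusTrace 5 := by
  haveI := Fact.mk (by norm_num : Nat.Prime 5)
  haveI := isGloballyMinimal_c718b1
  exact goodOrdinary_of_intModel_certificate intModel 5 (by decide +kernel) (n := 9) card_5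
    (by decide +kernel)

/-- **`N(718b1) = 718`** (semistable: `gcd(Δ, c₄) = 1`, `N = rad Δ`; Silverman ATAEC IV.10.2). [cite: CremonaAlgorithms1997, Table 1 (718b1)] -/
theorem conductorNorm_eq : ((⟨1, 0, 1, -5, 0⟩ : WeierstrassCurve ℤ).map (Int.castRingHom ℚ)).conductorNorm ℤ = 718 := by
  haveI := isElliptic_c718b1
  haveI := isGloballyMinimal_c718b1
  have h : ((⟨1, 0, 1, -5, 0⟩ : WeierstrassCurve ℤ).map (Int.castRingHom ℚ)) = (⟨1, 0, 1, -5, 0⟩ : WeierstrassCurve ℤ).baseChange ℚ :=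
    eq_baseChange_of_intModel intModel
  haveI : ((⟨1, 0, 1, -5, 0⟩ : WeierstrassCurve ℤ).baseChange ℚ).IsElliptic := by rw [← h]; infer_instance
  rw [h]
  refine BurungaleSkinner2023.conductorNorm_baseChange_int_of_isCoprime _
    (by rw [Int.isCoprime_iff_gcd_eq_one]; decide +kernel) (k := 4) ?_ (by decide +kernel)
    (by decide +kernel)
  rw [Nat.squarefree_iff_nodup_primeFactorsList (by norm_num)]; simp

/-- **Heegner data `d_K = -7` for `718b1`**: every prime of `Δ = 5744` (hence of `N_E`) splits in a quadratic
field of discriminant `-7` (Kronecker symbols `= 1`). [cite: Marcus1977, Ch. 3 Thm. 25] [cite: GrossLMS1991, §1] -/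
theorem heegner_neg7 : ∀ q : ℕ, q.Prime → (q : ℤ) ∣ (⟨1, 0, 1, -5, 0⟩ : WeierstrassCurve ℤ).Δ →
    (q = 2 → (-7 : ℤ) % 8 = 1) ∧ (q ≠ 2 → jacobiSym (-7) q = 1) :=
  forall_prime_dvd_of_natAbs_eq_pow_mul_pow (a := 2) (i := 4) (b := 359) (j := 1) (by decide +kernel)
    (by norm_num) (by norm_num) ⟨by norm_num, by norm_num⟩ ⟨by norm_num, by norm_num⟩

/-- **DEPTH-TABLE ROW `718b1`, `(p, d_K, ℓ) = (5, -7, 59)`, modulo Kolyvagin 1991 Thm. 4 (`hF`).** For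
`E = 718b1`, ANY imaginary quadratic `K` with `d_K = -7` (`h_K = 1`; such `K` exist, `Rank2Observatory.exists_heegnerField_5077a1`), any modular
parametrisation datum `Dt` of level `N_E`, `β`, `ι : K → ℂ`, and any Kolyvagin–Heegner datum `d` of conductor `59`
(a Kolyvagin prime: inert in `K`, `5 ∣ 60`, `5 ∣ a_59 = 5`): IF `c_1(59) ≠ 0` THEN `corank_ℤ5 Ш(E)[5^∞] = 0`,
`rank_ℤ E(ℚ) = 2`, `corank Sel_5∞(E/ℚ) = 2` and `corank Sel_5∞(E^(-7)/ℚ) = 1`. Every side condition is PROVED in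
the kernel; the inputs left are `hF` and the computed bit.
JLS cost `[K[59] : K] = 60`. BSD is not proved by it.
[cite: Kolyvagin1991MathAnn, §2 Thm. 4] [cite: JetchevLauterStein2009, §3.6 (arXiv:0707.0032)] -/
theorem depthRow_5_neg7_59 (hF : Kolyvagin1991_selmerCorank_of_kolyvaginClass_ne_zero)
    (K : Type) [Field K] [NumberField K] (hK : IsImaginaryQuadratic K)
    (hD : NumberField.discr K = -7) :
    haveI := isElliptic_c718b1;
    haveI := isGloballyMinimal_c718b1;
    haveI : NeZero (((⟨1, 0, 1, -5, 0⟩ : WeierstrassCurve ℤ).map (Int.castRingHom ℚ)).conductorNorm ℤ) := neZero_conductorNorm_of_isElliptic _;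
    ∀ (Dt : ModularParametrizationData ((⟨1, 0, 1, -5, 0⟩ : WeierstrassCurve ℤ).map (Int.castRingHom ℚ)) (((⟨1, 0, 1, -5, 0⟩ : WeierstrassCurve ℤ).map (Int.castRingHom ℚ)).conductorNorm ℤ)) (β : ℤ)
    (ι : K →+* ℂ) (d : KolyvaginHeegnerData Dt β ι 59),
    d.kolyvaginClass (p := 5) (by norm_num) 1 ≠ 0 →
    ((⟨1, 0, 1, -5, 0⟩ : WeierstrassCurve ℤ).map (Int.castRingHom ℚ)).shaCorank 5 = 0 ∧ ((⟨1, 0, 1, -5, 0⟩ : WeierstrassCurve ℤ).map (Int.castRingHom ℚ)).mordellWeilRank = 2 ∧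
      ((⟨1, 0, 1, -5, 0⟩ : WeierstrassCurve ℤ).map (Int.castRingHom ℚ)).selmerCorank 5 = 2 ∧
      (((⟨1, 0, 1, -5, 0⟩ : WeierstrassCurve ℤ).map (Int.castRingHom ℚ)).quadraticTwist ((-7 : ℤ) : ℚ)).selmerCorank 5 = 1 := by
  haveI := isElliptic_c718b1
  haveI := isGloballyMinimal_c718b1
  haveI : NeZero (((⟨1, 0, 1, -5, 0⟩ : WeierstrassCurve ℤ).map (Int.castRingHom ℚ)).conductorNorm ℤ) := neZero_conductorNorm_of_isElliptic _
  intro Dt β ι d hne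
  haveI := Fact.mk (by norm_num : Nat.Prime 5)
  exact depthRow_of_intModel_certificate intModel hF KernelCerts002.C718b1.two_le_rank 5 (by norm_num)
    (by decide +kernel) hasSurjectiveModNGaloisRep_5 K hK hD (by norm_num) (by norm_num) (by norm_num) heegner_neg7 59
    (by norm_num) (by norm_num) (by decide +kernel) (by norm_num) (by norm_num) (by norm_num) (by norm_num)
    (n := 55) card_59 (by norm_num) Dt β ι d hne

end C718b1

end Summit.BirchSwinnertonDyer.BirchSwinnertonDyer.Theorems.KolyvaginDepthDoor

end
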